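/-
COR-CM (cell pub-hodgecm2, stage 2 of the Hodge ladder) — Δ2 BRIDGE, (c)+(d) closure at ι₁ (coordinator ruling «WORLD = C», 2026-08-23;
ASSEMBLER MODULE TABLE v1.2 «ι₁ ∕ Id CHAIN», row I5 part A): the component morphisms `componentInjId K h : P_{Γ_K.conj h}(V) ⟶ M_K ⊗_{L,ι₁} ℂ`
of the UNTWISTED compactified Shimura variety `X_K := M_K` (instlevel-a's `Model.honestP5IdOf ∕ sec42DataIdOf`, `X_K = M_K` on the nose),
for EVERY index `h`, with the laws the J-record consumes — the `ι₁`-twin of prove-5 g0's `ShimuraComponentInj.lean` §3, in which the ONLY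
twisted ingredient `theta` (`X_K^{(c)} ⊗_{ῑ₁} ℂ ≅ M_K ⊗_{ι₁} ℂ`) is replaced by the record functor's own identification `M_K ≅ M_K` base-changed
ALONG `ι₁` (`thetaId`); no instance, no `starRingEnd`, no `cmConjRingHom` anywhere.  Seat prover-pub-hodgecm2-d2bridge-prove-5-g1-0 (g0's
successor; desk probe for pin-a's I5).  §1–§2 of g0's file (`levelOf`, `P`, `D`, `basePt`, `componentInj₀`, `componentInj₀_spec`) are
instance-free and record-level and are IMPORTED, not restated.  FRAMING: HC_CM is NOT proved; «Δ2 BRIDGE CLOSED» is NOT claimed;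
`exists_recordSystem`, `heckeTranslate_definedOver` are cited named facts taken as hypotheses, `hHD ∕ h₃ ∕ hA` the tower's parameters.
-/
import Summits.HodgeConjecture.CorCM.D2Bridge.ShimuraComponentInj
import HarnessLib

/-!
# Δ2 bridge, (J2) pin at ι₁, part A: `componentInjId K h : P_{Γ_K.conj h}(V) ⟶ M_K ⊗_{ι₁} ℂ` for every tower index `h`

[Liu2021] §4.2 l. 2060–2074, Prop. C.5; [Deligne1979ShimuraVarieties] 2.1.2–2.1.4, 2.2.5; [Milne2005ShimuraVarieties] Lemma 5.13, §13 p. 118.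
Setting: `L : HodgeCM.CMField`, `V : HodgeCM.HermSpace3 L ι₁`, `h4 : 4 ≤ [L:ℚ]`, `h : exists_recordSystem`, the record
`S = Model.recordOf h (pkgV V) h4` of models `M_K` over `L` ALONG `ι₁`, and the untwisted `X_K := (recordFunctorOf h (pkgV V)).obj K`
(`= (Model.sec42DataIdOfFourLe h (pkgV V) Φ h4 iso).X K` by `rfl`, instlevel-a `HComp/Sec42DataIdOf.lean`).  Every codomain is the
HONEST base change `(baseChangeHom ι₁).obj _` — which IS `(bcFunctor L ℂ).obj _` under the instance `ι₁.toAlgebra` (both unfold to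
`Over.pullback (Spec.map (CommRingCat.ofHom ι₁))`), the instance part B (`ComponentAlbanesePinId`) works under.
* §1 `XKId`, `thetaId K : X_K ⊗_{ι₁} ℂ ≅ M_K ⊗_{ι₁} ℂ` (`(baseChangeHom ι₁).mapIso (recordFunctorOf_objIso …)`) and its naturality;
* §2 `componentInjId K h := componentInj₀ ≫ thetaId⁻¹` and the LAWS `componentInjId_rel` (ii), `componentInjId_comp_recordFunctorHeckeTranslate` (iv),
  `componentInjId_comp_map` (iii), `componentInjId_eq_of_piece`, `exists_isColimit_componentInjId` (v) — g0's proofs with `theta_naturality`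
  replaced by plain functoriality of `baseChangeHom ι₁`.
HC_CM is NOT proved; nothing here is a display or a pointer move.
-/

set_option autoImplicit false

noncomputable section

open Function CategoryTheory CategoryTheory.Limits AlgebraicGeometry NumberField Matrix
open scoped Matrix
open Literature.AlgebraicGeometry.Motives Literature.AlgebraicGeometry.HodgeTheory Literature.AlgebraicGeometry.ShimuraVarieties
open Literature.AlgebraicGeometry.ShimuraVarieties.UnitaryCanonicalModel
open Literature.NumberTheory.Automorphic Literature.NumberTheory.Automorphic.UnitaryGroup Literature.NumberTheory.Automorphic.PicardCM
open Literature.NumberTheory.Automorphic.Liu2021 Literature.NumberTheory.Automorphic.Liu2021.AppendixC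
open Literature.NumberTheory.Transcendental (Arapura2012_Cor_15_4_6)
open Literature.Geometry.ComplexHyperbolic
open Literature.Geometry.ComplexHyperbolic.BallModel (Ball)
open Summit.HodgeConjecture.CorCM.Model Summit.HodgeConjecture.CorCM.HComp
open HodgeCM.Model HodgeCM.Model.LevelTranslate HodgeCM.Model.TowerLevel

namespace Summit.HodgeConjecture.CorCM.D2Bridge.Iota1

open Summit.HodgeConjecture.CorCM.D2Bridge

/-! ## §1 The untwisted `X_K` and `thetaId : X_K ⊗_{ι₁} ℂ ≅ M_K ⊗_{ι₁} ℂ` -/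

section Pin

variable {L : HodgeCM.CMField} {ι₁ : L →+* ℂ}

/-- Liu's `X_K = Sh(𝕍)_K` of the UNTWISTED honest datum: the record functor's `M_K` itself (definitionally the `X_K` of
`Model.sec42DataIdOfFourLe …`, instlevel-a's `sec42DataIdOfFourLe_X`). [cite: Liu2021, §4.2 l. 2062 and Prop. C.5] -/
abbrev XKId (V : HodgeCM.HermSpace3 L ι₁) (h : exists_recordSystem) (K : C5.SmallLevel (K3 (pkgV V))) : SchemeOver (pkgF L) :=
  (recordFunctorOf h (pkgV V)).obj K

/-- **`X_K ⊗_{ι₁} ℂ ≅ M_K ⊗_{ι₁} ℂ`** — the record functor's identification `recordFunctorOf_objIso` base-changed ALONG `ι₁`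
(no conjugation: the untwisted slot is the record's own complex fibre). [cite: Liu2021, Prop. C.5 l. 4627–4633] [cite: GortzWedhorn2020, Prop. 4.16] -/
def thetaId (V : HodgeCM.HermSpace3 L ι₁) (h4 : 4 ≤ Module.finrank ℚ L) (h : exists_recordSystem) (K : C5.SmallLevel (K3 (pkgV V))) :
    (baseChangeHom ι₁).obj (XKId V h K) ≅ (baseChangeHom ι₁).obj ((recordOf h (pkgV V) h4).M.obj K) :=
  (baseChangeHom ι₁).mapIso (recordFunctorOf_objIso h (pkgV V) h4 K)

/-- Unfolding `thetaId.hom` (`Functor.mapIso_hom`). [folklore] -/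
theorem thetaId_hom (V : HodgeCM.HermSpace3 L ι₁) (h4 : 4 ≤ Module.finrank ℚ L) (h : exists_recordSystem) (K : C5.SmallLevel (K3 (pkgV V))) :
    (thetaId V h4 h K).hom = (baseChangeHom ι₁).map (recordFunctorOf_objIso h (pkgV V) h4 K).hom := rfl

/-- Unfolding `thetaId.inv` (`Functor.mapIso_inv`). [folklore] -/
theorem thetaId_inv (V : HodgeCM.HermSpace3 L ι₁) (h4 : 4 ≤ Module.finrank ℚ L) (h : exists_recordSystem) (K : C5.SmallLevel (K3 (pkgV V))) :
    (thetaId V h4 h K).inv = (baseChangeHom ι₁).map (recordFunctorOf_objIso h (pkgV V) h4 K).inv := rfl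

/-- **Naturality of `thetaId`** along a morphism of models `m : M_K ⟶ M_{K'}` read on the `X_K` (plain functoriality of `baseChangeHom ι₁`).
[cite: GortzWedhorn2020, Prop. 4.16] -/
theorem thetaId_naturality (V : HodgeCM.HermSpace3 L ι₁) (h4 : 4 ≤ Module.finrank ℚ L) (h : exists_recordSystem) {K K' : C5.SmallLevel (K3 (pkgV V))}
    (m : (recordOf h (pkgV V) h4).M.obj K ⟶ (recordOf h (pkgV V) h4).M.obj K') :
    (baseChangeHom ι₁).map
        ((recordFunctorOf_objIso h (pkgV V) h4 K).hom ≫ m ≫ (recordFunctorOf_objIso h (pkgV V) h4 K').inv) ≫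
        (thetaId V h4 h K').hom =
      (thetaId V h4 h K).hom ≫ (baseChangeHom ι₁).map m := by
  rw [thetaId_hom, thetaId_hom, ← Functor.map_comp, ← Functor.map_comp, Category.assoc, Category.assoc, Iso.inv_hom_id,
    Category.comp_id]

/-- `thetaId⁻¹` absorbs a conjugated model morphism: `thetaId_K⁻¹ ≫ (ι₁)_*(objIso ≫ m ≫ objIso⁻¹) = (ι₁)_* m ≫ thetaId_{K'}⁻¹`. [folklore] -/
theorem thetaId_inv_comp_map (V : HodgeCM.HermSpace3 L ι₁) (h4 : 4 ≤ Module.finrank ℚ L) (h : exists_recordSystem) {K K' : C5.SmallLevel (K3 (pkgV V))}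
    (m : (recordOf h (pkgV V) h4).M.obj K ⟶ (recordOf h (pkgV V) h4).M.obj K') :
    (thetaId V h4 h K).inv ≫ (baseChangeHom ι₁).map
        ((recordFunctorOf_objIso h (pkgV V) h4 K).hom ≫ m ≫ (recordFunctorOf_objIso h (pkgV V) h4 K').inv) =
      (baseChangeHom ι₁).map m ≫ (thetaId V h4 h K').inv := by
  rw [thetaId_inv, thetaId_inv, ← Functor.map_comp, ← Functor.map_comp, Iso.inv_hom_id_assoc]

/-! ## §2 The component morphisms `componentInjId K h : P_{Γ_K.conj h} ⟶ X_K ⊗_{ι₁} ℂ` and their laws -/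

/-- **The component morphism `P_{Γ_K.conj h}(V) ⟶ X_K ⊗_{ι₁} ℂ` of index `h`** for the UNTWISTED `X_K = M_K` — the piece
`Γ_h\𝔹² ↪ X_K(ℂ)`, `[z] ↦ [z, hK]` ([Deligne1979ShimuraVarieties] 2.1.2), for EVERY `h`: g0's `componentInj₀` re-targeted along `thetaId⁻¹`.
[cite: Deligne1979ShimuraVarieties, §2.1.2] [cite: Liu2021, §4.2 l. 2062 and Prop. C.5] -/
def componentInjId (V : HodgeCM.HermSpace3 L ι₁) (hU : BallQuotientUniformisedDatum)
    (h₃ : CMAbelianVarietyRealised) (h4 : 4 ≤ Module.finrank ℚ L) (h : exists_recordSystem) (hHD : exists_isReal_hodgeModel)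
    (K : C5.SmallLevel (K3 (pkgV V))) (hh : V.adelicFin) :
    P V hU h₃ K hh ⟶ (baseChangeHom ι₁).obj (XKId V h K) :=
  componentInj₀ V hU h₃ h4 h hHD K hh ≫ (thetaId V h4 h K).inv

/-- Unfolding `componentInjId` (`rfl`). [folklore] -/
theorem componentInjId_def (V : HodgeCM.HermSpace3 L ι₁) (hU : BallQuotientUniformisedDatum)
    (h₃ : CMAbelianVarietyRealised) (h4 : 4 ≤ Module.finrank ℚ L) (h : exists_recordSystem) (hHD : exists_isReal_hodgeModel)
    (K : C5.SmallLevel (K3 (pkgV V))) (hh : V.adelicFin) :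
    componentInjId V hU h₃ h4 h hHD K hh = componentInj₀ V hU h₃ h4 h hHD K hh ≫ (thetaId V h4 h K).inv := rfl

set_option maxHeartbeats 4000000 in
/-- **LAW (ii) — `Rel`-coherence ON THE NOSE**: for `TowerLevel.Rel Γ_K γ h h'`, `componentInjId K h = transMor γ ≫ componentInjId K h'`
(the two indices name the same component, identified by `z ↦ γz`). [cite: Deligne1979ShimuraVarieties, §2.1.2] [cite: Milne2005ShimuraVarieties, Lemma 5.13 p. 57 and Prop. 13.1 p. 117] -/
theorem componentInjId_rel (V : HodgeCM.HermSpace3 L ι₁) (hU : BallQuotientUniformisedDatum)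
    (h₃ : CMAbelianVarietyRealised) (h4 : 4 ≤ Module.finrank ℚ L) (h : exists_recordSystem) (hHD : exists_isReal_hodgeModel)
    (hA : Arapura2012_Cor_15_4_6) (K : C5.SmallLevel (K3 (pkgV V))) {hh hh' : V.adelicFin} {γ : ↥(Urat V)}
    (r : Rel (levelOf V K) γ hh hh') :
    componentInjId V hU h₃ h4 h hHD K hh =
      transMor hU h₃ hHD hA γ.2 ((levelOf V K).conj hh (belowConjThree_levelOf V K))
          ((levelOf V K).conj hh' (belowConjThree_levelOf V K)) (transCond_of_rel (belowConjThree_levelOf V K) r) ≫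
        componentInjId V hU h₃ h4 h hHD K hh' := by
  have key := componentMap_eq_comp_of_rel (recordOf h (pkgV V) h4) K γ r (D V hU h₃ h4 K hh) (D V hU h₃ h4 K hh')
    (D_Hℂ V hU h₃ h4 K hh) (D_Hℂ V hU h₃ h4 K hh')
    (transMor hU h₃ hHD hA γ.2 ((levelOf V K).conj hh (belowConjThree_levelOf V K))
      ((levelOf V K).conj hh' (belowConjThree_levelOf V K)) (transCond_of_rel (belowConjThree_levelOf V K) r))
    (fun v hv => map_transMor_unif hU h₃ hHD hA γ.2 _ (isAnisotropic_of_two_lt L ι₁ V (levelOf V K) (by omega)) hv)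
    (componentInj₀ V hU h₃ h4 h hHD K hh) (componentInj₀ V hU h₃ h4 h hHD K hh')
    (componentInj₀_spec V hU h₃ h4 h hHD K hh) (componentInj₀_spec V hU h₃ h4 h hHD K hh')
  rw [componentInjId, componentInjId, key, Category.assoc]

set_option maxHeartbeats 4000000 in
/-- **LAW (iv) — Hecke translates ON THE NOSE** for the untwisted `X_K`, at the record functor's Hecke translate
`recordFunctorHeckeTranslate … g K₁ K hle = objIso ≫ T_g ≫ objIso⁻¹` (`HComp/HeckeTranslatesOfRecord`; = the `tr g K₁ K hle` field of the
untwisted Hecke translates I2 — the twisted `heckeTranslatesOf_tr` minus the outer `(baseChangeHom (cmConjRingHom F)).map`;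
[Milne2005ShimuraVarieties] Thm. 13.6 via `hU7`; `g⁻¹K₁g ⊆ K`): `componentInjId K₁ h ≫ (T_g)_ℂ = transMor 1 ≫ componentInjId K (hg)`
(«`T(g) : [x, aK] ↦ [x, agK′]`»). [cite: Milne2005ShimuraVarieties, §13 p. 118 L21–26 and Thm. 13.6] [cite: Liu2021, §4.2 l. 2074] -/
theorem componentInjId_comp_recordFunctorHeckeTranslate (V : HodgeCM.HermSpace3 L ι₁) (hU : BallQuotientUniformisedDatum)
    (h₃ : CMAbelianVarietyRealised) (h4 : 4 ≤ Module.finrank ℚ L) (h : exists_recordSystem) (hHD : exists_isReal_hodgeModel)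
    (hA : Arapura2012_Cor_15_4_6) (hU7 : heckeTranslate_definedOver)
    {K₁ K : C5.SmallLevel (K3 (pkgV V))} (g : V.adelicFin) (hle : C5.HeckeLE g K₁ K) (hh : V.adelicFin) :
    (componentInjId V hU h₃ h4 h hHD K₁ hh ≫
        (baseChangeHom ι₁).map (recordFunctorHeckeTranslate hU7 h (pkgV V) h4 g K₁ K hle) :
        P V hU h₃ K₁ hh ⟶ (baseChangeHom ι₁).obj (XKId V h K)) =
      transMor hU h₃ hHD hA (Subgroup.one_mem (Urat V)) ((levelOf V K₁).conj hh (belowConjThree_levelOf V K₁))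
          ((levelOf V K).conj (hh * g) (belowConjThree_levelOf V K)) (transCond_conj_mul_of_heckeLE V hle hh) ≫
        componentInjId V hU h₃ h4 h hHD K (hh * g) := by
  have key := componentMap_comp_heckeTranslate (recordOf h (pkgV V) h4) g hh
    (isHeckeTranslate_recordHeckeTranslate hU7 h (pkgV V) h4 g K₁ K hle) (D V hU h₃ h4 K₁ hh) (D V hU h₃ h4 K (hh * g))
    (D_Hℂ V hU h₃ h4 K₁ hh)
    (transMor hU h₃ hHD hA (Subgroup.one_mem (Urat V)) ((levelOf V K₁).conj hh (belowConjThree_levelOf V K₁))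
      ((levelOf V K).conj (hh * g) (belowConjThree_levelOf V K)) (transCond_conj_mul_of_heckeLE V hle hh))
    (fun v hv => by
      rw [map_transMor_unif hU h₃ hHD hA _ _ (isAnisotropic_of_two_lt L ι₁ V (levelOf V K) (by omega)) hv]
      simp only [glι, map_one, Units.val_one, one_mulVec])
    (componentInj₀ V hU h₃ h4 h hHD K₁ hh) (componentInj₀ V hU h₃ h4 h hHD K (hh * g))
    (componentInj₀_spec V hU h₃ h4 h hHD K₁ hh) (componentInj₀_spec V hU h₃ h4 h hHD K (hh * g))
  rw [recordFunctorHeckeTranslate, componentInjId, componentInjId, Category.assoc, thetaId_inv_comp_map, ← Category.assoc, key,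
    Category.assoc]

set_option maxHeartbeats 4000000 in
/-- **LAW (iii) — level transitions ON THE NOSE** (`K ≤ K'`, `u : X_K ⟶ X_{K'}` = the record functor's map, `[z, aK] ↦ [z, aK']`):
`componentInjId K h ≫ u_ℂ = transMor 1 ≫ componentInjId K' h`. [cite: Deligne1979ShimuraVarieties, 2.1.4] [cite: Liu2021, §4.2 l. 2062–2064] -/
theorem componentInjId_comp_map (V : HodgeCM.HermSpace3 L ι₁) (hU : BallQuotientUniformisedDatum)
    (h₃ : CMAbelianVarietyRealised) (h4 : 4 ≤ Module.finrank ℚ L) (h : exists_recordSystem) (hHD : exists_isReal_hodgeModel)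
    (hA : Arapura2012_Cor_15_4_6) {K K' : C5.SmallLevel (K3 (pkgV V))} (f : K ⟶ K')
    (hh : V.adelicFin) :
    (componentInjId V hU h₃ h4 h hHD K hh ≫ (baseChangeHom ι₁).map ((recordFunctorOf h (pkgV V)).map f) :
        P V hU h₃ K hh ⟶ (baseChangeHom ι₁).obj (XKId V h K')) =
      transMor hU h₃ hHD hA (Subgroup.one_mem (Urat V)) ((levelOf V K).conj hh (belowConjThree_levelOf V K))
          ((levelOf V K').conj hh (belowConjThree_levelOf V K'))
          (transCond_conj_of_le (levelOf_mono V f.le) (belowConjThree_levelOf V K') (belowConjThree_levelOf V K) hh) ≫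
        componentInjId V hU h₃ h4 h hHD K' hh := by
  have key := componentMap_comp_map (recordOf h (pkgV V) h4) f hh (D V hU h₃ h4 K hh) (D V hU h₃ h4 K' hh)
    (D_Hℂ V hU h₃ h4 K hh)
    (transMor hU h₃ hHD hA (Subgroup.one_mem (Urat V)) ((levelOf V K).conj hh (belowConjThree_levelOf V K))
      ((levelOf V K').conj hh (belowConjThree_levelOf V K'))
      (transCond_conj_of_le (levelOf_mono V f.le) (belowConjThree_levelOf V K') (belowConjThree_levelOf V K) hh))
    (fun v hv => by
      rw [map_transMor_unif hU h₃ hHD hA _ _ (isAnisotropic_of_two_lt L ι₁ V (levelOf V K) (by omega)) hv]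
      simp only [glι, map_one, Units.val_one, one_mulVec])
    (componentInj₀ V hU h₃ h4 h hHD K hh) (componentInj₀ V hU h₃ h4 h hHD K' hh)
    (componentInj₀_spec V hU h₃ h4 h hHD K hh) (componentInj₀_spec V hU h₃ h4 h hHD K' hh)
  have hmap' : (recordFunctorOf h (pkgV V)).map f = (recordFunctorOf_objIso h (pkgV V) h4 K).hom ≫
      (recordOf h (pkgV V) h4).M.map f ≫ (recordFunctorOf_objIso h (pkgV V) h4 K').inv := by
    rw [← Category.assoc, Iso.eq_comp_inv]
    exact (recordFunctorOfIso h (pkgV V) h4).hom.naturality f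
  rw [hmap', componentInjId, componentInjId, Category.assoc, thetaId_inv_comp_map, ← Category.assoc, key, Category.assoc]

set_option maxHeartbeats 4000000 in
/-- A ball-quotient piece `X'` mapping into `M_K ⊗_{ι₁} ℂ` by `[T·lift x] ↦ [x, g K]` IS the component of index `g` up to the model-match
isomorphism `e : X' ≅ P_{Γ_K.conj g}` over the uniformisations: `componentInjId K g = e⁻¹ ≫ ι' ≫ thetaId⁻¹`. [cite: Deligne1979ShimuraVarieties, §2.1.2] [cite: Mumford1981, §4B (4.15) Corollary, p. 67] -/
theorem componentInjId_eq_of_piece (V : HodgeCM.HermSpace3 L ι₁) (hU : BallQuotientUniformisedDatum)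
    (h₃ : CMAbelianVarietyRealised) (h4 : 4 ≤ Module.finrank ℚ L) (h : exists_recordSystem) (hHD : exists_isReal_hodgeModel)
    (K : C5.SmallLevel (K3 (pkgV V))) (g : V.adelicFin) {X' : SchemeOver ℂ}
    (B' : UnitaryBallUniformisationDatum 2 X') (hB' : B'.Hℂ = V.Hm.map ι₁)
    (ι' : X' ⟶ (baseChangeHom ι₁).obj ((recordOf h (pkgV V) h4).M.obj K))
    (hι' : ∀ x : Ball, AlgPoints.map ι' (B'.unif ((frameOf (pkgV V) : Matrix (Fin 3) (Fin 3) ℂ) *ᵥ BallModel.lift x)) =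
      AlgPoints.baseChangeEquiv ι₁ ((recordOf h (pkgV V) h4).M.obj K)
        (((recordOf h (pkgV V) h4).pts K).symm (ShimuraSet.mk _ _ _ _ _ K.1.1 x g)))
    (e : X' ≅ P V hU h₃ K g) (he : ∀ v ∈ B'.cone, AlgPoints.map e.hom (B'.unif v) = (D V hU h₃ h4 K g).unif v) :
    componentInjId V hU h₃ h4 h hHD K g = e.inv ≫ ι' ≫ (thetaId V h4 h K).inv := by
  have hq : e.hom ≫ componentInj₀ V hU h₃ h4 h hHD K g = ι' := by
    haveI := isSeparated_baseChange_record (recordOf h (pkgV V) h4) K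
    refine hom_ext_of_frame (formCongr_frameOf (pkgV V)) B' hB' fun x => ?_
    have hcone : (frameOf (pkgV V) : Matrix (Fin 3) (Fin 3) ℂ) *ᵥ BallModel.lift x ∈ B'.cone := by
      change _ ∈ negCone B'.Hℂ
      rw [hB']
      exact frame_mulVec_lift_mem_negCone (formCongr_frameOf (pkgV V)) x
    rw [AlgPoints.map_comp_apply, he _ hcone, componentInj₀_spec, hι' x]
  rw [Iso.eq_inv_comp, componentInjId, ← Category.assoc, hq]

set_option maxHeartbeats 4000000 in
/-- **LAW (v) — the components at the record's representatives `g_q` of `Ξ_K` form a coproduct cofan of `X_K ⊗_{ι₁} ℂ`** for the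
UNTWISTED `X_K = M_K` («`M_ℂ` is the disjoint sum of the `Γ_g\X⁺`»; the record's `pieces` cofan, pieces identified by
`UnitaryBallModelUnique.exists_iso_of_eq`, legs compared by `componentInjId_eq_of_piece`) — THE cofan along `ι₁` (d2bridge-ref's (W1)).
[cite: Deligne1979ShimuraVarieties, §2.1.2] [cite: Mumford1981, §4B (4.15) Corollary, p. 67] -/
theorem exists_isColimit_componentInjId (V : HodgeCM.HermSpace3 L ι₁) (hU : BallQuotientUniformisedDatum)
    (h₃ : CMAbelianVarietyRealised) (h4 : 4 ≤ Module.finrank ℚ L) (h : exists_recordSystem) (hHD : exists_isReal_hodgeModel)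
    (K : C5.SmallLevel (K3 (pkgV V))) :
    ∃ (Ξ : Type) (_ : Finite Ξ) (g : Ξ → V.adelicFin),
      Nonempty (IsColimit (Cofan.mk ((baseChangeHom ι₁).obj (XKId V h K)) (fun q => componentInjId V hU h₃ h4 h hHD K (g q)))) := by
  classical
  obtain ⟨g, -, X, ι, hcol, B, hB⟩ := (recordOf h (pkgV V) h4).pieces K
  haveI := Summit.HodgeConjecture.CorCM.Model.finite_shimuraIndex (pkgV V) h4 (K.1.1 : Subgroup V.adelicFin) K.1.2.1
  refine ⟨_, inferInstance, g, ?_⟩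
  -- each record piece IS the tree surface of its index, over the uniformisations
  have hiso : ∀ q, ∃ e : X q ≅ P V hU h₃ K (g q),
      ∀ v ∈ (B q).cone, AlgPoints.map e.hom ((B q).unif v) = (D V hU h₃ h4 K (g q)).unif v := by
    intro q
    obtain ⟨hH1, hΓ1, -⟩ := hB q
    have hH2 : (B q).Hℂ = (D V hU h₃ h4 K (g q)).Hℂ := by rw [hH1, D_Hℂ]
    have hΓ2 : (B q).Γ.map (Matrix.GeneralLinearGroup.map (B q).τ₁) =
        (D V hU h₃ h4 K (g q)).Γ.map (Matrix.GeneralLinearGroup.map (D V hU h₃ h4 K (g q)).τ₁) := by rw [hΓ1, D_map_Γ]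
    obtain ⟨e, he, -⟩ := UnitaryBallModelUnique.exists_iso_of_eq_of_nonempty
      (X₁ := X q) (X₂ := P V hU h₃ K (g q)) (D₁ := B q) (D₂ := D V hU h₃ h4 K (g q))
      (let ⟨A, _⟩ := exists_isReal_hodgeModel_holds 2 (X q) (B q).isSmoothProjective; ⟨A⟩)
      ⟨BettiUniverse.realHodgeModel hHD (isSmoothProjective_P V hU h₃ K (g q))⟩ hH2 hΓ2
    exact ⟨e, he⟩
  choose e he using hiso
  have hleg : ∀ q, componentInjId V hU h₃ h4 h hHD K (g q) = (e q).inv ≫ ι q ≫ (thetaId V h4 h K).inv := fun q =>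
    componentInjId_eq_of_piece V hU h₃ h4 h hHD K (g q) (B q) (hB q).1 (ι q) (hB q).2.2 (e q) (he q)
  have hfun : (fun q => componentInjId V hU h₃ h4 h hHD K (g q)) = fun q => (e q).symm.hom ≫ (ι q ≫ (thetaId V h4 h K).inv) :=
    funext fun q => by rw [hleg q, Iso.symm_hom]
  rw [hfun]
  exact nonempty_isColimit_cofan_of_iso (fun q => ι q ≫ (thetaId V h4 h K).inv)
    (hcol.ofIsoColimit (Cofan.ext (thetaId V h4 h K).symm (fun _ => rfl))) (fun q => (e q).symm)

end Pin

end Summit.HodgeConjecture.CorCM.D2Bridge.Iota1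

end
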